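import Literature.AnabelianGeometry.EtaleTheta.Discharge.Sec2Cor219iiiAtModelChiOfStable
import Literature.AnabelianGeometry.EtaleTheta.Discharge.Sec2TowerRowsAtModelTateOfExtendsOfValue
import HarnessLib

/-!
# [EtTh] Cor. 2.19 (iii), Cor. 2.19 (ii) and the Cor. 2.18 (iv) tower rows AT THE TATE DATUM OF RECORD ⟸ hextΔ / hextParity ALONE
# (the displayed value clause (H-b) RETIRED; proof-only, one term each)

S. Mochizuki, *The étale theta function and its Frobenioid-theoretic manifestations* [EtTh], Publ. RIMS **45** (2009), §2:
Cor. 2.19 (iii) p. 64 [cite: MochizukiEtTh2009, Cor 2.19 (iii) p.64] «every automorphism of the mono-theta environment preserves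
the theta classes up to a constant multiple», Cor. 2.19 (ii) p. 64, Cor. 2.18 (iv) p. 61 (lifting / surjectivity / odd bijectivity),
Cor. 2.18 (i) p. 60 (the subquotients `(l·Δ_Θ)`, `(Π^tp_X)^Θ` are group-theoretic), Prop. 2.4 (i) p. 38 (extension of automorphisms).

abc-iut cell, layer L2, seat abc-iut-L2-t2 (gen 13); self-named row «COR219III-(H.a)-ONLY KNIT @TATE-DATUM» found by the M17 census
(abc-iut-L2-lead R1158 (9)); abc-iut-L6-lead §F v1.19dy «(H.a) ⟸ hextΔ by ONE TERM — L2's book».  PROOF-ONLY: 0 definitions /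
instances / notations / `Prop` facts; nothing of another seat edited or restated — inputs consumed BY NAME.

STATE OF RECORD BEFORE THIS FILE.  abc-iut-L2-d1's p493713 (`Sec2TowerRowsAtModelTateOfExtendsOfValue`) gives F-0650
`ThetaEnvTower.Cor219_iii` for the tower of the Tate datum of record (`modelχq p 1 2`, `E := etaleThetaDataχqInr p`, record `X̲̲`-choice
`C.Huu = Huuχq`, any cyclotome tower `τ`) ⟸ {hextΔ, (H-b)}, and the Cor. 2.18 (iv) / Cor. 2.19 (ii) rows ⟸ {hextParity, (H-b)}, where (H-b)
was the displayed «value at b₀ for a level-constant conjugator» clause of abc-iut-L1-t6's p490953.  Meanwhile abc-iut-L1-t6's p495968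
(`Sec2Cor219iiiAtModelChiOfStable`, K-L6 row «COR219III-M1b», CLOSED-DELIVERED by abc-iut-L6-lead 2026-08-27T04:23:58Z) proves
`cor219_iii_modelTate_inr_of_thetaKer_stable`: the SAME conclusion modulo the two Cor. 2.18 (i)-type stability clauses (H.a) ONLY —
`γ(Ker θ|_{Π^tp_X̲̲}) = Ker θ|_{Π^tp_X̲̲}` and `γ(θ⁻¹(l·Δ_Θ)) = θ⁻¹(l·Δ_Θ)` for every admissible `(γ, hγ, γμ, hcompat)` — plus ONE root
cocycle `f₀` taken as data; NO value clause.

THIS FILE (one term each, nothing new in mathematics):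
* `DoubleUnderline.exists_mem_rootCocycles` — at EVERY §1 datum the root cocycles `η̲̈^{Θ,l·ℤ×μ₂}` are inhabited (the distinguished
  lift of `DoubleUnderline.eta_res`, class in the orbit via `σ = 1`; the argument of `thetaCocycles_nonempty`), so p495968's data binder
  `f₀` is discharged;
* `cor219_iii_modelTate_inr_of_thetaKer_stable_alone` — p495968 with `f₀` supplied: F-0650 at the datum ⟸ (H.a) ONLY;
* `cor219_iii_modelTate_inr_of_extends_alone` — **F-0650 at the datum ⟸ hextΔ (2-clause) ALONE**: (H.a) is discharged from hextΔ
  exactly as in p493713 (abc-iut-L2-d1's backbone `map_subgroupOf_Huu_eq_of_extends` with `map_ker_toTheta_eq` /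
  `map_comap_lDeltaTheta_eq`, p417661: the tower's two subgroups ARE the setting's `Ker θ` / `θ⁻¹(l·Δ_Θ)` cut out on `C.Huu`);
  `…_of_parity_alone` — the same ⟸ hextParity (drop the parity conjunct);
* the Cor. 2.18 (iv) / Cor. 2.19 (ii) rows of abc-iut-f-148's p491715 with `h219iii` SUPPLIED: `cor219_ii_modelTate_inr_of_parity_alone`
  (F-0649), `rigidData_/thetaEnvData_cor218_iv_surjective_modAll_modelTate_inr_of_parity_alone` (F-0625 / F-0639 = layer L6's
  [IUTchII] Prop. 1.5 bridge input `hsurj`), `cor218_iv_bijective_of_odd_modelTate_inr_of_parity_alone` (F-0647),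
  `sec2_tower_rows_modelTate_inr_of_parity_alone` (Cor. 2.16 ∧ Cor. 2.18 (iv) reduction ∧ odd bijectivity ∧ Cor. 2.19 (ii)) —
  **⟸ hextParity ALONE, EVERY `p`**; and, over abc-iut-f-148's `Sec2TowerRowsAtModelTateOfExtendsModFour` (p490418), the same four
  **⟸ hextΔ ALONE for `p ≡ 1 (mod 4)`** (`…_of_extends_alone_of_mod_four_eq_one`).
* (v2, §4) `cor219_iii_modelχq_of_extends_alone` — the same for EVERY Tate instance `(i, j)` (`j` even) and every étale-theta
  datum of `modelχq p i j`, modulo `Compat`/`Sec2Hyps`/Prop. 1.5 (iii) of the datum (p495968's general theorem), ⟸ hextΔ ALONE.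
RESIDUAL OF RECORD after this file (Cor2.19(iii) / Cor2.19(ii) / Cor2.18(iv) cells, K4 row 21): {hextΔ resp. hextParity} = the [EtTh]
Prop. 2.4 (i)-shape binder of K4 rows 19/22 (Cor. 2.18 (i) / Cor. 2.19 (i)) — UNDECIDED at the semi-synthetic model (abc-iut-L6-lead
§F v1.19ec: every tree family extends, p496371; the 2-adic and 3-adic refuter routes are closed) — and NOTHING else beyond data.

HONEST FRAMING: `modelχq` is a SEMI-SYNTHETIC model of the typed §1 interface (not the tempered `π₁` of a curve) — binder-discharge
evidence for OUR typed rows only; F-0650 / F-0649 / F-0625 / F-0639 / F-0647 stay FACT-policy rows (assumption labels by ID); hextΔ /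
hextParity are DISPLAYED binders, not asserted; nothing of [EtTh] (refereed) is asserted beyond the displayed statements; no side is taken on
[IUTchIII] Cor. 3.12; typed ≠ proved; conditional-at-a-model ≠ proved in print; re-closed ≠ endorsed; nothing here says abc is proved
or refuted.
-/

noncomputable section

namespace Literature.AnabelianGeometry.EtaleTheta

open Literature.AnabelianGeometry.SemiGraphs _root_.Function _root_.Topology

/-! ## §0. Root cocycles exist at every §1 datum -/

namespace ThetaSetting.EtaleThetaData.DoubleUnderline

variable {p : ℕ} [Fact p.Prime] {D : ThetaSetting p} {E : D.EtaleThetaData} {l : ℕ} (C : E.DoubleUnderline l)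

/-- **The cocycles of `η̲̈^{Θ,l·ℤ×μ₂}` are inhabited** at every §1 datum: the distinguished `l·Δ_Θ`-valued lift of
`η̈^Θ|_{Π^tp_Ÿ̲̲}` of `DoubleUnderline.eta_res` (p. 41 «the class `η̈^Θ` determines a class `η̲̈^Θ ∈ H¹(Π^tp_Ÿ̲̲, l·Δ_Θ)`»),
whose class lies in the orbit through `σ = 1`.  [cite: MochizukiEtTh2009, Def 2.7 p.41] -/
theorem exists_mem_rootCocycles (hC : D.Compat) :
    ∃ f₀ : contCocycles D.toTheta D.DeltaTheta C.GtpYdduu, f₀ ∈ C.rootCocycles hC := by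
  obtain ⟨f, hf, hval, hmk⟩ := C.eta_res
  haveI := hC.GtpYdd_normal
  have horb : ContH1.mk f hf ∈ C.etaOrbit hC := by
    refine ⟨1, one_mem _, ?_⟩
    rw [contH1_conj_one]
    exact hmk
  exact ⟨⟨f, hf⟩, hval, horb⟩

end ThetaSetting.EtaleThetaData.DoubleUnderline

namespace SettingModel

variable (p : ℕ) [Fact p.Prime] {l : ℕ+} (hl : Odd (l : ℕ))
  (C : (etaleThetaDataχqInr p).DoubleUnderline l) (hHuu : C.Huu = Huuχq p 1 2 l hl) {Es : Set ℕ+}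
  (τ : (ThetaSetting.modelχq p 1 2 even_two).CyclotomeTower l Es)

/-! ## §1. F-0650 `ThetaEnvTower.Cor219_iii` at the datum of record ⟸ (H.a) only / ⟸ hextΔ alone / ⟸ hextParity alone -/

set_option synthInstance.maxHeartbeats 200000 in
set_option maxHeartbeats 1000000 in
include hHuu in
/-- **F-0650 `ThetaEnvTower.Cor219_iii` for the tower of the étale-theta datum OF RECORD at the Tate instance, modulo the
Cor. 2.18 (i)-type stability clauses (H.a) ONLY** — abc-iut-L1-t6's `cor219_iii_modelTate_inr_of_thetaKer_stable` (p495968) with its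
root-cocycle datum `f₀` SUPPLIED by `DoubleUnderline.exists_mem_rootCocycles`.  The two `set_option`s only raise elaboration limits
for the nested carriers (as in p495968). [cite: MochizukiEtTh2009, Cor 2.19 (iii) p.64] -/
theorem cor219_iii_modelTate_inr_of_thetaKer_stable_alone
    (Ha : ∀ (γ : (C.thetaEnvTower τ (compat_modelχq p 1 2 even_two) (ThetaSetting.modelχq_sec2Hyps p 1 2 even_two)).PiX ≃ₜ*
        (C.thetaEnvTower τ (compat_modelχq p 1 2 even_two) (ThetaSetting.modelχq_sec2Hyps p 1 2 even_two)).PiX)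
      (_ : (C.thetaEnvTower τ (compat_modelχq p 1 2 even_two) (ThetaSetting.modelχq_sec2Hyps p 1 2 even_two)).PiYdd.map
          γ.toMulEquiv.toMonoidHom =
        (C.thetaEnvTower τ (compat_modelχq p 1 2 even_two) (ThetaSetting.modelχq_sec2Hyps p 1 2 even_two)).PiYdd)
      (γμ : ∀ M : Es, (C.thetaEnvTower τ (compat_modelχq p 1 2 even_two) (ThetaSetting.modelχq_sec2Hyps p 1 2 even_two)).mu M ≃*
        (C.thetaEnvTower τ (compat_modelχq p 1 2 even_two) (ThetaSetting.modelχq_sec2Hyps p 1 2 even_two)).mu M)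
      (_ : ∀ (M : Es) (g : (C.thetaEnvTower τ (compat_modelχq p 1 2 even_two) (ThetaSetting.modelχq_sec2Hyps p 1 2 even_two)).lDeltaTheta)
        (hg : γ g ∈ (C.thetaEnvTower τ (compat_modelχq p 1 2 even_two) (ThetaSetting.modelχq_sec2Hyps p 1 2 even_two)).lDeltaTheta),
        (C.thetaEnvTower τ (compat_modelχq p 1 2 even_two) (ThetaSetting.modelχq_sec2Hyps p 1 2 even_two)).thetaMod M ⟨γ g, hg⟩ =
          γμ M ((C.thetaEnvTower τ (compat_modelχq p 1 2 even_two) (ThetaSetting.modelχq_sec2Hyps p 1 2 even_two)).thetaMod M g)),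
      ((ThetaSetting.modelχq p 1 2 even_two).toTheta.comp C.Huu.subtype).ker.map γ.toMulEquiv.toMonoidHom =
          ((ThetaSetting.modelχq p 1 2 even_two).toTheta.comp C.Huu.subtype).ker ∧
      (C.thetaEnvTower τ (compat_modelχq p 1 2 even_two) (ThetaSetting.modelχq_sec2Hyps p 1 2 even_two)).lDeltaTheta.map
          γ.toMulEquiv.toMonoidHom =
        (C.thetaEnvTower τ (compat_modelχq p 1 2 even_two) (ThetaSetting.modelχq_sec2Hyps p 1 2 even_two)).lDeltaTheta) :
    (C.thetaEnvTower τ (compat_modelχq p 1 2 even_two) (ThetaSetting.modelχq_sec2Hyps p 1 2 even_two)).Cor219_iii := by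
  obtain ⟨f₀, hf₀⟩ := C.exists_mem_rootCocycles (compat_modelχq p 1 2 even_two)
  exact cor219_iii_modelTate_inr_of_thetaKer_stable p hl C hHuu τ f₀ hf₀ Ha

/- The two DISPLAYED binders of the rows below, as section variables (binders, NOT definitions; `include`d theorem by
theorem): **hextΔ** = «every topological automorphism of `Π^tp_X̲̲ = C.Huu` extends to a `Δ^tp_X`-stabilising topological
automorphism of `Π^tp_X(modelχq p 1 2)`» (the [EtTh] Prop. 2.4 (i)-shape binder of K4 rows 19/22, abc-iut-L2-d1 / abc-iut-L6-d6), and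
**hextParity** = hextΔ with abc-iut-f-148's parity conjunct (p491715: the level-2 `y`-coordinate of `Γ(inl b̂)` vanishes). -/
variable
  (hextΔ : ∀ γ : ↥C.Huu ≃ₜ* ↥C.Huu, ∃ Γ : PiTpχq p 1 2 ≃ₜ* PiTpχq p 1 2,
    (∀ h : C.Huu, Γ (h : PiTpχq p 1 2) = ((γ h : C.Huu) : PiTpχq p 1 2)) ∧
      (curveχq p 1 2).DeltaTemp.map Γ.toMulEquiv.toMonoidHom = (curveχq p 1 2).DeltaTemp)
  (hextParity : ∀ γ : ↥C.Huu ≃ₜ* ↥C.Huu, ∃ Γ : PiTpχq p 1 2 ≃ₜ* PiTpχq p 1 2,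
    (∀ h : C.Huu, Γ (h : PiTpχq p 1 2) = ((γ h : C.Huu) : PiTpχq p 1 2)) ∧
      (curveχq p 1 2).DeltaTemp.map Γ.toMulEquiv.toMonoidHom = (curveχq p 1 2).DeltaTemp ∧
      (levelHom 2 (Γ (SemidirectProduct.inl (gfpOf (FreeGroup.of 0)))).left).y = 0)

set_option synthInstance.maxHeartbeats 200000 in
set_option maxHeartbeats 1000000 in
include hHuu hextΔ in
/-- **F-0650 `ThetaEnvTower.Cor219_iii` at the datum of record FROM hextΔ ALONE**: the (H.a) clauses — stability of `Ker(θ|_{Π^tp_X̲̲})`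
and of the tower's `θ⁻¹(l·Δ_Θ)` under every admissible `γ` — are discharged from hextΔ by abc-iut-L2-d1's backbone
(`map_subgroupOf_Huu_eq_of_extends` with `map_ker_toTheta_eq` / `map_comap_lDeltaTheta_eq`, p417661), verbatim as in p493713; the value
clause (H-b) of p493713 is no longer a hypothesis. [cite: MochizukiEtTh2009, Cor 2.19 (iii) p.64] -/
theorem cor219_iii_modelTate_inr_of_extends_alone :
    (C.thetaEnvTower τ (compat_modelχq p 1 2 even_two) (ThetaSetting.modelχq_sec2Hyps p 1 2 even_two)).Cor219_iii := by
  refine cor219_iii_modelTate_inr_of_thetaKer_stable_alone p hl C hHuu τ (fun γ _ _ _ => ?_)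
  obtain ⟨Γ, hΓ, hΔ⟩ := hextΔ γ
  refine ⟨?_, ?_⟩
  · have h1 := C.map_subgroupOf_Huu_eq_of_extends γ Γ hΓ _
      ((ThetaSetting.modelχq p 1 2 even_two).map_ker_toTheta_eq Γ hΔ)
    rw [← MonoidHom.comap_ker, Subgroup.comap_subtype]
    exact h1
  · have h2 := C.map_subgroupOf_Huu_eq_of_extends γ Γ hΓ _
      ((ThetaSetting.modelχq p 1 2 even_two).map_comap_lDeltaTheta_eq l Γ hΔ)
    change (((ThetaSetting.modelχq p 1 2 even_two).lDeltaTheta l).comap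
        ((ThetaSetting.modelχq p 1 2 even_two).toTheta.comp C.Huu.subtype)).map γ.toMulEquiv.toMonoidHom =
      ((ThetaSetting.modelχq p 1 2 even_two).lDeltaTheta l).comap
        ((ThetaSetting.modelχq p 1 2 even_two).toTheta.comp C.Huu.subtype)
    rw [← Subgroup.comap_comap, Subgroup.comap_subtype]
    exact h2

include hHuu hextParity in
/-- hextParity ⇒ hextΔ (drop the parity conjunct): **F-0650 at the datum ⟸ hextParity ALONE**, every `p`.
[cite: MochizukiEtTh2009, Cor 2.19 (iii) p.64] -/
theorem cor219_iii_modelTate_inr_of_parity_alone :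
    (C.thetaEnvTower τ (compat_modelχq p 1 2 even_two) (ThetaSetting.modelχq_sec2Hyps p 1 2 even_two)).Cor219_iii :=
  cor219_iii_modelTate_inr_of_extends_alone p hl C hHuu τ fun γ =>
    (hextParity γ).imp fun _ h => ⟨h.1, h.2.1⟩

/-! ## §2. The Cor. 2.19 (ii) / Cor. 2.18 (iv) rows at the datum ⟸ hextParity ALONE, every `p` -/

include hHuu hextParity in
/-- **F-0649 `ThetaEnvTower.Cor219_ii` for the tower of the datum of record ⟸ hextParity ALONE, EVERY `p`** (abc-iut-f-148's
`cor219_ii_modelTate_inr_of_extends_of_parity`, p491715, with `h219iii` SUPPLIED by §1). [cite: MochizukiEtTh2009, Cor 2.19 (ii) p.64] -/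
theorem cor219_ii_modelTate_inr_of_parity_alone :
    (C.thetaEnvTower τ (compat_modelχq p 1 2 even_two) (ThetaSetting.modelχq_sec2Hyps p 1 2 even_two)).Cor219_ii :=
  cor219_ii_modelTate_inr_of_extends_of_parity p C τ hextParity
    (cor219_iii_modelTate_inr_of_parity_alone p hl C hHuu τ hextParity)

include hHuu hextParity in
/-- **F-0625 `RigidData.Cor218_iv_surjective` at every `modAll` level of the datum of record (empty labelling) ⟸ hextParity ALONE,
EVERY `p`** (p491715 with `h219iii` supplied). [cite: MochizukiEtTh2009, Cor 2.18 (iv) p.61] -/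
theorem rigidData_cor218_iv_surjective_modAll_modelTate_inr_of_parity_alone (M : ℕ+) :
    (C.rigidData (τ.modAll M) (compat_modelχq p 1 2 even_two) (ThetaSetting.modelχq_sec2Hyps p 1 2 even_two)
      (prop15iii_etaleThetaDataχqInr p _) ⟨fun _ => ∅, fun _ => ∅, fun _ => rfl⟩).Cor218_iv_surjective :=
  rigidData_cor218_iv_surjective_modAll_modelTate_inr_of_extends_of_parity p C τ M hextParity
    (cor219_iii_modelTate_inr_of_parity_alone p hl C hHuu τ hextParity)

include hHuu hextParity in
/-- **F-0639 the same in `ThetaEnvData` currency** (layer L6's [IUTchII] Prop. 1.5 bridge input `hsurj`) ⟸ hextParity ALONE, EVERY `p`.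
[cite: MochizukiEtTh2009, Cor 2.18 (iv) p.61] -/
theorem thetaEnvData_cor218_iv_surjective_modAll_modelTate_inr_of_parity_alone (M : ℕ+) :
    (C.thetaEnvData (τ.modAll M) (compat_modelχq p 1 2 even_two)
      (ThetaSetting.modelχq_sec2Hyps p 1 2 even_two)).Cor218_iv_surjective :=
  thetaEnvData_cor218_iv_surjective_modAll_modelTate_inr_of_extends_of_parity p C τ M hextParity
    (cor219_iii_modelTate_inr_of_parity_alone p hl C hHuu τ hextParity)

include hHuu hextParity in
/-- **F-0647 odd bijectivity of Cor. 2.18 (iv) for the tower of the datum of record ⟸ hextParity ALONE, EVERY `p`.**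
[cite: MochizukiEtTh2009, Cor 2.18 (iv) p.61] -/
theorem cor218_iv_bijective_of_odd_modelTate_inr_of_parity_alone :
    (C.thetaEnvTower τ (compat_modelχq p 1 2 even_two) (ThetaSetting.modelχq_sec2Hyps p 1 2 even_two)).Cor218_iv_bijective_of_odd :=
  cor218_iv_bijective_of_odd_modelTate_inr_of_extends_of_parity p C τ hextParity
    (cor219_iii_modelTate_inr_of_parity_alone p hl C hHuu τ hextParity)

include hHuu hextParity in
/-- **The §2 tower-row census conjunction at the datum of record** (Cor. 2.16 ∧ Cor. 2.18 (iv) reduction ∧ odd bijectivity ∧ Cor. 2.19 (ii),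
abc-iut-f-148's `sec2_tower_rows_modelTate_inr_of_extends_of_parity`) **⟸ hextParity ALONE, EVERY `p`**.
[cite: MochizukiEtTh2009, Cor 2.19 (ii) p.64] -/
theorem sec2_tower_rows_modelTate_inr_of_parity_alone :
    (C.thetaEnvTower τ (compat_modelχq p 1 2 even_two) (ThetaSetting.modelχq_sec2Hyps p 1 2 even_two)).Cor216 ∧
    (C.thetaEnvTower τ (compat_modelχq p 1 2 even_two) (ThetaSetting.modelχq_sec2Hyps p 1 2 even_two)).Cor218_iv_reduction ∧
    (C.thetaEnvTower τ (compat_modelχq p 1 2 even_two) (ThetaSetting.modelχq_sec2Hyps p 1 2 even_two)).Cor218_iv_bijective_of_odd ∧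
    (C.thetaEnvTower τ (compat_modelχq p 1 2 even_two) (ThetaSetting.modelχq_sec2Hyps p 1 2 even_two)).Cor219_ii :=
  sec2_tower_rows_modelTate_inr_of_extends_of_parity p C τ hextParity
    (cor219_iii_modelTate_inr_of_parity_alone p hl C hHuu τ hextParity)

/-! ## §3. The same rows ⟸ hextΔ ALONE for `p ≡ 1 (mod 4)` (over abc-iut-f-148's `…OfExtendsModFour`, p490418) -/

include hHuu hextΔ in
/-- **F-0649 Cor. 2.19 (ii) at the datum ⟸ hextΔ ALONE, `p ≡ 1 (mod 4)`.** [cite: MochizukiEtTh2009, Cor 2.19 (ii) p.64] -/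
theorem cor219_ii_modelTate_inr_of_extends_alone_of_mod_four_eq_one (hp : p % 4 = 1) :
    (C.thetaEnvTower τ (compat_modelχq p 1 2 even_two) (ThetaSetting.modelχq_sec2Hyps p 1 2 even_two)).Cor219_ii :=
  cor219_ii_modelTate_inr_of_extends_of_mod_four_eq_one p C τ hp hextΔ
    (cor219_iii_modelTate_inr_of_extends_alone p hl C hHuu τ hextΔ)

include hHuu hextΔ in
/-- **F-0647 odd bijectivity at the datum ⟸ hextΔ ALONE, `p ≡ 1 (mod 4)`.** [cite: MochizukiEtTh2009, Cor 2.18 (iv) p.61] -/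
theorem cor218_iv_bijective_of_odd_modelTate_inr_of_extends_alone_of_mod_four_eq_one (hp : p % 4 = 1) :
    (C.thetaEnvTower τ (compat_modelχq p 1 2 even_two) (ThetaSetting.modelχq_sec2Hyps p 1 2 even_two)).Cor218_iv_bijective_of_odd :=
  cor218_iv_bijective_of_odd_modelTate_inr_of_extends_of_mod_four_eq_one p C τ hp hextΔ
    (cor219_iii_modelTate_inr_of_extends_alone p hl C hHuu τ hextΔ)

include hHuu hextΔ in
/-- **F-0625 `RigidData.Cor218_iv_surjective` at every `modAll` level ⟸ hextΔ ALONE, `p ≡ 1 (mod 4)`.**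
[cite: MochizukiEtTh2009, Cor 2.18 (iv) p.61] -/
theorem rigidData_cor218_iv_surjective_modAll_modelTate_inr_of_extends_alone_of_mod_four_eq_one (hp : p % 4 = 1) (M : ℕ+) :
    (C.rigidData (τ.modAll M) (compat_modelχq p 1 2 even_two) (ThetaSetting.modelχq_sec2Hyps p 1 2 even_two)
      (prop15iii_etaleThetaDataχqInr p _) ⟨fun _ => ∅, fun _ => ∅, fun _ => rfl⟩).Cor218_iv_surjective :=
  rigidData_cor218_iv_surjective_modAll_modelTate_inr_of_extends_of_mod_four_eq_one p C τ hp M hextΔ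
    (cor219_iii_modelTate_inr_of_extends_alone p hl C hHuu τ hextΔ)

include hHuu hextΔ in
/-- **F-0639 the same in `ThetaEnvData` currency ⟸ hextΔ ALONE, `p ≡ 1 (mod 4)`.** [cite: MochizukiEtTh2009, Cor 2.18 (iv) p.61] -/
theorem thetaEnvData_cor218_iv_surjective_modAll_modelTate_inr_of_extends_alone_of_mod_four_eq_one (hp : p % 4 = 1) (M : ℕ+) :
    (C.thetaEnvData (τ.modAll M) (compat_modelχq p 1 2 even_two)
      (ThetaSetting.modelχq_sec2Hyps p 1 2 even_two)).Cor218_iv_surjective :=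
  thetaEnvData_cor218_iv_surjective_modAll_modelTate_inr_of_extends_of_mod_four_eq_one p C τ hp M hextΔ
    (cor219_iii_modelTate_inr_of_extends_alone p hl C hHuu τ hextΔ)

include hHuu hextΔ in
/-- **The §2 tower-row census conjunction at the datum ⟸ hextΔ ALONE, `p ≡ 1 (mod 4)`.** [cite: MochizukiEtTh2009, Cor 2.19 (ii) p.64] -/
theorem sec2_tower_rows_modelTate_inr_of_extends_alone_of_mod_four_eq_one (hp : p % 4 = 1) :
    (C.thetaEnvTower τ (compat_modelχq p 1 2 even_two) (ThetaSetting.modelχq_sec2Hyps p 1 2 even_two)).Cor216 ∧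
    (C.thetaEnvTower τ (compat_modelχq p 1 2 even_two) (ThetaSetting.modelχq_sec2Hyps p 1 2 even_two)).Cor218_iv_reduction ∧
    (C.thetaEnvTower τ (compat_modelχq p 1 2 even_two) (ThetaSetting.modelχq_sec2Hyps p 1 2 even_two)).Cor218_iv_bijective_of_odd ∧
    (C.thetaEnvTower τ (compat_modelχq p 1 2 even_two) (ThetaSetting.modelχq_sec2Hyps p 1 2 even_two)).Cor219_ii :=
  sec2_tower_rows_modelTate_inr_of_extends_of_mod_four_eq_one p C τ hp hextΔ
    (cor219_iii_modelTate_inr_of_extends_alone p hl C hHuu τ hextΔ)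

/-! ## §4. Every Tate instance `(i, j)` (`j` even), every étale-theta datum: F-0650 at `modelχq p i j` ⟸ hextΔ ALONE
(modulo `Compat` / `Sec2Hyps` / Prop. 1.5 (iii) of the datum, as in p495968's general theorem) -/

set_option synthInstance.maxHeartbeats 200000 in
set_option maxHeartbeats 1000000 in
/-- **F-0650 `ThetaEnvTower.Cor219_iii` at `modelχq p i j` FROM hextΔ ALONE** — the general form of
`cor219_iii_modelTate_inr_of_extends_alone`: for every `i`, every even `j`, every étale-theta datum `E` of `modelχq p i j`, the
record `X̲̲`-choice (`C.Huu = Huuχq p i j l`), `l` odd, every cyclotome tower, given `Compat`, `Sec2Hyps` and Prop. 1.5 (iii) of the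
datum (as in abc-iut-L1-t6's `cor219_iii_modelχq_of_thetaKer_stable`, p495968): the (H.a) clauses are discharged from hextΔ by
abc-iut-L2-d1's backbone (generic over the setting) and the root cocycle by `exists_mem_rootCocycles`.
[cite: MochizukiEtTh2009, Cor 2.19 (iii) p.64] -/
theorem cor219_iii_modelχq_of_extends_alone (i j : ℤ) (hj : Even j)
    {E' : (ThetaSetting.modelχq p i j hj).EtaleThetaData} {l' : ℕ+} (hl' : Odd (l' : ℕ))
    (C' : E'.DoubleUnderline l') (hHuu' : C'.Huu = Huuχq p i j l' hl') {Es' : Set ℕ+}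
    (τ' : (ThetaSetting.modelχq p i j hj).CyclotomeTower l' Es')
    (hC : (ThetaSetting.modelχq p i j hj).Compat) (hS : (ThetaSetting.modelχq p i j hj).Sec2Hyps)
    (h15 : ThetaSetting.Prop15iii E' hC)
    (hextΔ' : ∀ γ : ↥C'.Huu ≃ₜ* ↥C'.Huu, ∃ Γ : PiTpχq p i j ≃ₜ* PiTpχq p i j,
      (∀ h : C'.Huu, Γ (h : PiTpχq p i j) = ((γ h : C'.Huu) : PiTpχq p i j)) ∧
        (curveχq p i j).DeltaTemp.map Γ.toMulEquiv.toMonoidHom = (curveχq p i j).DeltaTemp) :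
    (C'.thetaEnvTower τ' hC hS).Cor219_iii := by
  obtain ⟨f₀, hf₀⟩ := C'.exists_mem_rootCocycles hC
  refine cor219_iii_modelχq_of_thetaKer_stable p i j hj hl' C' hHuu' τ' hC hS h15 f₀ hf₀ (fun γ _ _ _ => ?_)
  obtain ⟨Γ, hΓ, hΔ⟩ := hextΔ' γ
  refine ⟨?_, ?_⟩
  · have h1 := C'.map_subgroupOf_Huu_eq_of_extends γ Γ hΓ _
      ((ThetaSetting.modelχq p i j hj).map_ker_toTheta_eq Γ hΔ)
    rw [← MonoidHom.comap_ker, Subgroup.comap_subtype]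
    exact h1
  · have h2 := C'.map_subgroupOf_Huu_eq_of_extends γ Γ hΓ _
      ((ThetaSetting.modelχq p i j hj).map_comap_lDeltaTheta_eq l' Γ hΔ)
    change (((ThetaSetting.modelχq p i j hj).lDeltaTheta l').comap
        ((ThetaSetting.modelχq p i j hj).toTheta.comp C'.Huu.subtype)).map γ.toMulEquiv.toMonoidHom =
      ((ThetaSetting.modelχq p i j hj).lDeltaTheta l').comap
        ((ThetaSetting.modelχq p i j hj).toTheta.comp C'.Huu.subtype)
    rw [← Subgroup.comap_comap, Subgroup.comap_subtype]
    exact h2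

end SettingModel

end Literature.AnabelianGeometry.EtaleTheta

end
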